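import Summits.PneNP.PneNP.Theorems.ChebyshevTracialDesignSmallBlockMaskPricingHH
import Summits.PneNP.PneNP.Theorems.ChebyshevTracialDesignBlockMaskAverage
import Literature.Combinatorics.Optimization.ShellLawRelativeLevelSmoothness
import HarnessLib

/-!
# Cell pnp-psdrank, route `ChebyshevTracialDesign`: SMALL BLOCKS — THE UNTILTED MASK AVERAGED OVER ALL MATCHINGS
# (brick T-K4; crux `TracialDecayExp20`, stmt-PneNP-19878)

Brick (T-K4) (engine seat g24; eng MEMO-23 §3). The design value `Σ_M Σ_U W(U,M)·ψ(|U ∩ H|)` of the untilted `H`-symmetric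
mask on a SMALL block `|H| = h` is the average over the perfect matchings `M` of the per-matching values priced by brick
(T-K3) (`ChebyshevTracialDesignSmallBlockMaskPricingHH.smallBlockHH_designValue_le`: `≤ B_v·C((T−1)/2,D−a+1)·3^a·G·q_b^{D−a+1}`
for a matching with `a` internal and `b = h − 2a` crossing edges). Splitting the matchings by the number `a = a(M,H)` of internal
edges: for `a ≤ a₀` the per-matching bound is `≤ B_v·3^{a₀}·G·θ^{D−a₀+1}` as soon as `((T−1)/2)·¼(h/R)²e^{3h/R} ≤ θ ≤ 1`
(monotonicity in `b ≤ h`, `C(m,k)q^k ≤ (mq)^k`); for `a > a₀` the trivial bound `G·B_v` (brick 128c `blockMask_value_le_trivial`)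
is charged to the MASS of such matchings, `#{M : a(M,H) > a₀} = #{M : cr(H,M) ≤ h − 2(a₀+1)} ≤ (h+1)·ρ^{a₀+1}·|PM|` by the
crossing-count lower tail of eng g20 (`ChebyshevTracialDesignCrossingCountTails.card_filter_cr_le_le`, threshold `h − 2(a₀+1)`,
`m = a₀+1`) under the one-line hypothesis `(b+1)(b+2) ≤ ρ(h−b)(n−h−b)` for `b < h`, which holds with `ρ = h(h+1)/(n−2h+1)`:

* §1 `choose_mul_pow_le_mul_pow`, `qParam_mono` (monotonicity of `q_b = ¼(b/R)²e^{3b/R}` in `b`), `rho_hyp_of_le`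
  (the one-line hypothesis with `ρ = h(h+1)/(n−2h+1)` when `2h ≤ n`), `card_pmatch_internal_gt_le` (the `a`-tail of the
  matching measure: `#{M : cr(H,M) + 2(a₀+1) ≤ h} ≤ (h+1)·ρ^{a₀+1}·|PMatch n|`).
* §2 **`smallBlock_designValue_avg_le`** — for an exact design `(n,t,T,D,B_v,C,w)` (`n = 2N`, `t = 2s₀+1`), a block `|H| = h`,
  `a₀ ≤ D`, `R ≥ 1` with `R + 3(D+1) + h + (T−1)/2 ≤ s₀+1`, `R + 3(D+1) + h + s₀ + (T−1)/2 + 1 ≤ N`, `(h/R)²e^{3h/R} ≤ 2`,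
  `((T−1)/2)·¼(h/R)²e^{3h/R} ≤ θ ≤ 1`, the hypothesis `(b+1)(b+2) ≤ ρ(h−b)(n−h−b)` for `b < h`, and every `0 ≤ ψ ≤ G`:
  `Σ_M Σ_U W(U,M)·ψ(|U∩H|) ≤ B_v·G·(3^{a₀}·θ^{D−a₀+1} + (h+1)·ρ^{a₀+1})`;
  **`smallBlock_designValue_avg_le'`** — the same with `ρ = h(h+1)/(n−2h+1)` (`2h ≤ n`);
  (v2) **`smallBlock_designValue_avg_le_three_pow`** — the headline form: if `9h(h+1) ≤ n − 2h + 1` and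
  `((T−1)/2)·¼(h/R)²e^{3h/R} ≤ 1/9` then `Σ_M Σ_U W(U,M)·ψ(|U∩H|) ≤ B_v·G·(h+2)·3^{−⌊D/2⌋}` (`a₀ = ⌊D/2⌋`).
READING (eng MEMO-23 §3): for `h ≤ n^{1/2−ε}` take `a₀ ≍ D/2`: `ρ^{a₀} ≈ n^{−εD}` and `θ ≲ 2h²e^{…}/n^{3/2} ≪ 1`, so the untilted
`H`-symmetric class on every block of at most `n^{1/2−ε}` vertices has super-polynomially small DESIGN VALUE — the small-block
companion of brick 128c (balanced blocks), EFFECTIVE (no `n₀`). WHAT THIS FILE DOES NOT DO: blocks between `n^{3/4}` and `βn`;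
tilted masks; anything on `TracialDecayExp20` itself, psd rank of P_PM(K_n), or P vs NP.
[cite: Rothvoss2017, §2 (PDF pp. 5–6)] [cite: Agarwal2000DifferenceEquations, Remark 1.8.1 (1.8.8)]
Stature: support/instrument (kernel lane, no defs, axioms standard). Supports stmt-PneNP-19878.
-/

set_option linter.dupNamespace false -- `Summit.PneNP.PneNP.…`: summit = sub-problem (D-0017)

noncomputable section

namespace Summit.PneNP.PneNP.Theorems.ChebyshevTracialDesignSmallBlockMaskAverage

open Finset Literature.Barriers.PneNP Literature.Combinatorics.Optimization
open Literature.Combinatorics.Optimization.ShellStep Literature.Combinatorics.SimpleGraph.CycleSpace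
open Summit.PneNP.PneNP.Theorems.ChebyshevTracialDesignJunta
open Summit.PneNP.PneNP.Theorems.ChebyshevTracialDesignClosedPairCount (card_filter_pmatch)
open Summit.PneNP.PneNP.Theorems.ChebyshevTracialDesignCrossingCountTails (card_filter_cr_le_le pos_of_lower_hyp)
open Summit.PneNP.PneNP.Theorems.ChebyshevTracialDesignCrossingCountTailsExplicit (card_filter_crosses_eq
  card_pmatch_eq_card_perfectMatchings)
open Summit.PneNP.PneNP.Theorems.ChebyshevTracialDesignCrossingPlaneAverage (card_reps_vB_eq_card_crosses)
open Summit.PneNP.PneNP.Theorems.ChebyshevTracialDesignBlockMaskAverage (blockMask_value_le_trivial)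
open Summit.PneNP.PneNP.Theorems.ChebyshevTracialDesignSmallBlockMaskPricingHH (smallBlockHH_designValue_le)

variable {n : ℕ}

/-! ### §1 Numerics, monotonicity, and the `a`-tail of the matching measure -/

/-- `C(m,k)·q^k ≤ (m·q)^k` for `q ≥ 0`. [cite: Agarwal2000DifferenceEquations, Remark 1.8.1] -/
theorem choose_mul_pow_le_mul_pow (m k : ℕ) {q : ℝ} (hq : 0 ≤ q) :
    ((m.choose k : ℕ) : ℝ) * q ^ k ≤ ((m : ℝ) * q) ^ k := by
  rw [mul_pow]
  exact mul_le_mul_of_nonneg_right (by exact_mod_cast Nat.choose_le_pow m k) (pow_nonneg hq k)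

/-- Monotonicity of `q_b = ¼(b/R)²e^{3b/R}` in `b`. [cite: Rothvoss2017, §2 (PDF p. 6)] -/
theorem qParam_mono {b h R : ℕ} (hbh : b ≤ h) :
    (1 / 4 : ℝ) * ((b : ℝ) / R) ^ 2 * Real.exp (3 * b / R) ≤ (1 / 4 : ℝ) * ((h : ℝ) / R) ^ 2 * Real.exp (3 * h / R) := by
  have hbh' : (b : ℝ) ≤ h := by exact_mod_cast hbh
  have hR : (0 : ℝ) ≤ R := Nat.cast_nonneg R
  have h1 : (b : ℝ) / R ≤ (h : ℝ) / R := div_le_div_of_nonneg_right hbh' hR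
  have h2 : Real.exp (3 * b / R) ≤ Real.exp (3 * h / R) :=
    Real.exp_le_exp.2 (div_le_div_of_nonneg_right (by linarith) hR)
  have h3 : ((b : ℝ) / R) ^ 2 ≤ ((h : ℝ) / R) ^ 2 := pow_le_pow_left₀ (by positivity) h1 2
  exact mul_le_mul (mul_le_mul_of_nonneg_left h3 (by norm_num)) h2 (by positivity) (by positivity)

/-- **The one-line lower-tail hypothesis for a small block**: if `2h ≤ n` then for every `b < h`,
`(b+1)(b+2) ≤ ρ·(h−b)(n−h−b)` with `ρ = h(h+1)/(n−2h+1)`. [cite: Rothvoss2017, §2 (PDF p. 5)] -/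
theorem rho_hyp_of_le {h : ℕ} (hn : 2 * h ≤ n) {b : ℕ} (hb : b < h) :
    ((b : ℝ) + 1) * ((b : ℝ) + 2) ≤
      ((h : ℝ) * ((h : ℝ) + 1) / (((n - 2 * h + 1 : ℕ)) : ℝ)) * (((h - b : ℕ) : ℝ) * (((n - h - b : ℕ)) : ℝ)) := by
  have hden : (0 : ℝ) < ((n - 2 * h + 1 : ℕ) : ℝ) := by positivity
  have h1 : (1 : ℝ) ≤ ((h - b : ℕ) : ℝ) := by exact_mod_cast (show 1 ≤ h - b by omega)
  have h2 : (((n - 2 * h + 1 : ℕ)) : ℝ) ≤ ((n - h - b : ℕ) : ℝ) := by exact_mod_cast (show n - 2 * h + 1 ≤ n - h - b by omega)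
  have hb1 : (b : ℝ) + 1 ≤ h := by exact_mod_cast (show b + 1 ≤ h by omega)
  have hprod : (((n - 2 * h + 1 : ℕ)) : ℝ) ≤ ((h - b : ℕ) : ℝ) * ((n - h - b : ℕ) : ℝ) := by
    calc (((n - 2 * h + 1 : ℕ)) : ℝ) = 1 * ((n - 2 * h + 1 : ℕ) : ℝ) := (one_mul _).symm
      _ ≤ ((h - b : ℕ) : ℝ) * ((n - h - b : ℕ) : ℝ) := mul_le_mul h1 h2 hden.le (by positivity)
  calc ((b : ℝ) + 1) * ((b : ℝ) + 2) ≤ (h : ℝ) * ((h : ℝ) + 1) := by nlinarith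
    _ = ((h : ℝ) * ((h : ℝ) + 1) / ((n - 2 * h + 1 : ℕ) : ℝ)) * ((n - 2 * h + 1 : ℕ) : ℝ) := by field_simp
    _ ≤ _ := mul_le_mul_of_nonneg_left hprod (by positivity)

/-- **The `a`-tail of the matching measure.** For `H ⊆ Fin n` with `|H| = h` and `ρ` with `(b+1)(b+2) ≤ ρ(h−b)(n−h−b)` for all
`b < h`: the matchings with MORE than `a₀` edges inside `H`, i.e. `cr(H,M) + 2(a₀+1) ≤ h`, number at most `(h+1)·ρ^{a₀+1}·|PMatch n|`
(eng g20's lower tail `card_filter_cr_le_le` at threshold `h − 2(a₀+1)`, `m = a₀+1`; empty if `2(a₀+1) > h`).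
[cite: Rothvoss2017, §2 (PDF p. 5)] -/
theorem card_pmatch_internal_gt_le (H : Finset (Fin n)) {a₀ : ℕ} {ρ : ℝ} (hρ0 : 0 ≤ ρ)
    (hρ : ∀ b : ℕ, b < H.card → ((b : ℝ) + 1) * ((b : ℝ) + 2) ≤ ρ * (((H.card - b : ℕ) : ℝ) * (((n - H.card - b : ℕ)) : ℝ))) :
    (((univ.filter fun M : PMatch n => (M.1.filter (Crosses H)).card + 2 * (a₀ + 1) ≤ H.card).card : ℕ) : ℝ) ≤
      ((H.card : ℝ) + 1) * ρ ^ (a₀ + 1) * (Fintype.card (PMatch n) : ℝ) := by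
  by_cases hsmall : H.card < 2 * (a₀ + 1)
  · have h0 : (univ.filter fun M : PMatch n => (M.1.filter (Crosses H)).card + 2 * (a₀ + 1) ≤ H.card) = ∅ :=
      filter_eq_empty_iff.2 fun M _ h => by omega
    rw [h0, card_empty, Nat.cast_zero]
    positivity
  have hsmall' : 2 * (a₀ + 1) ≤ H.card := not_lt.1 hsmall
  have hc : (univ \ H).card = n - H.card := by rw [card_univ_sdiff, Fintype.card_fin]
  have h1 := card_filter_cr_le_le (subset_univ H) (ρ := ρ) (a₀ := H.card - 2 * (a₀ + 1)) (m := a₀ + 1)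
    (fun b hb => by rw [hc]; exact hρ b (by omega))
  have key : (univ.filter fun M : PMatch n => (M.1.filter (Crosses H)).card + 2 * (a₀ + 1) ≤ H.card).card =
      ((perfectMatchings (univ : Finset (Fin n))).filter fun M =>
        (M.filter fun e => cutCount H e = 1).card ≤ H.card - 2 * (a₀ + 1)).card := by
    rw [← card_filter_pmatch (fun M => (M.filter fun e => cutCount H e = 1).card ≤ H.card - 2 * (a₀ + 1))]
    congr 1
    exact filter_congr fun M _ => by rw [card_filter_crosses_eq]; omega
  rw [key, card_pmatch_eq_card_perfectMatchings]
  refine h1.trans (mul_le_mul_of_nonneg_right (mul_le_mul_of_nonneg_right ?_ (pow_nonneg hρ0 _)) (by positivity))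
  have : (((H.card - 2 * (a₀ + 1) : ℕ)) : ℝ) ≤ H.card := by exact_mod_cast Nat.sub_le _ _
  linarith

/-! ### §2 The average over the matchings -/

/-- **SMALL BLOCKS: THE UNTILTED MASK AVERAGED OVER ALL MATCHINGS (brick T-K4).** For an exact design `(n,t,T,D,B_v,C,w)` with
`n = 2N`, `t = 2s₀+1`, a block `H` with `|H| = h`, a cut-off `a₀ ≤ D`, an integer `R ≥ 1` with `R + 3(D+1) + h + (T−1)/2 ≤ s₀+1`,
`R + 3(D+1) + h + s₀ + (T−1)/2 + 1 ≤ N`, `(h/R)²e^{3h/R} ≤ 2`, a number `θ` with `((T−1)/2)·¼(h/R)²e^{3h/R} ≤ θ ≤ 1`, a number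
`ρ ≥ 0` with `(b+1)(b+2) ≤ ρ(h−b)(n−h−b)` for all `b < h`, and every mask `0 ≤ ψ ≤ G` on `[0,t]`:
`Σ_M Σ_U W(U,M)·ψ(|U∩H|) ≤ B_v·G·(3^{a₀}·θ^{D−a₀+1} + (h+1)·ρ^{a₀+1})` — matchings with `a ≤ a₀` internal edges by brick
(T-K3), the others by the trivial bound and the `a`-tail. [cite: Rothvoss2017, §2 (PDF pp. 5–6)]
[cite: Agarwal2000DifferenceEquations, Remark 1.8.1 (1.8.8)] -/
theorem smallBlock_designValue_avg_le {t T D : ℕ} {Bv : ℝ} {C : Finset ℕ} {w : ℕ → ℝ}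
    (hdes : IsExactDesign n t T D Bv C w) {N : ℕ} (hn : (univ : Finset (Fin n)).card = 2 * N)
    (H : Finset (Fin n)) {h s₀ a₀ R : ℕ} (hh : H.card = h) (ht : t = 2 * s₀ + 1) (ha₀ : a₀ ≤ D) (hR : 1 ≤ R)
    (hR1 : R + 3 * (D + 1) + h + (T - 1) / 2 ≤ s₀ + 1) (hR2 : R + 3 * (D + 1) + h + s₀ + (T - 1) / 2 + 1 ≤ N)
    (hq : ((h : ℝ) / R) ^ 2 * Real.exp (3 * h / R) ≤ 2) {θ : ℝ}
    (hθ : ((((T - 1) / 2 : ℕ)) : ℝ) * ((1 / 4 : ℝ) * ((h : ℝ) / R) ^ 2 * Real.exp (3 * h / R)) ≤ θ) (hθ1 : θ ≤ 1)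
    {ρ : ℝ} (hρ0 : 0 ≤ ρ)
    (hρ : ∀ b : ℕ, b < h → ((b : ℝ) + 1) * ((b : ℝ) + 2) ≤ ρ * (((h - b : ℕ) : ℝ) * (((n - h - b : ℕ)) : ℝ)))
    (ψ : ℤ → ℝ) {G : ℝ} (hG0 : 0 ≤ G) (hG : ∀ x ∈ Icc (0 : ℤ) (t : ℤ), |ψ x| ≤ G)
    (hψ0 : ∀ x ∈ Icc (0 : ℤ) (t : ℤ), 0 ≤ ψ x) :
    ∑ M : PMatch n, ∑ U : OddSet n, levelWeight n t C w U M * ψ ((U.1 ∩ H).card : ℤ) ≤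
      Bv * G * ((3 : ℝ) ^ a₀ * θ ^ (D - a₀ + 1) + ((h : ℝ) + 1) * ρ ^ (a₀ + 1)) := by
  classical
  have hBv : 0 ≤ Bv := le_trans (sum_nonneg fun c _ => abs_nonneg _) hdes.2.2.2.2.2.2
  have hθ0 : 0 ≤ θ := le_trans (by positivity) hθ
  rcases isEmpty_or_nonempty (PMatch n) with hE | ⟨⟨M₀⟩⟩
  · rw [Fintype.sum_empty]; positivity
  set V : PMatch n → ℝ := fun M => (Fintype.card (PMatch n) : ℝ) * ∑ U : OddSet n,
    levelWeight n t C w U M * ψ ((U.1 ∩ H).card : ℤ) with hVdef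
  obtain ⟨B₁, hB₁⟩ : ∃ e : ℝ, e = Bv * G * ((3 : ℝ) ^ a₀ * θ ^ (D - a₀ + 1)) := ⟨_, rfl⟩
  obtain ⟨B₂, hB₂⟩ : ∃ e : ℝ, e = G * Bv := ⟨_, rfl⟩
  have hB₁0 : 0 ≤ B₁ := by rw [hB₁]; positivity
  have hB₂0 : 0 ≤ B₂ := by rw [hB₂]; positivity
  set good : Finset (PMatch n) := univ.filter fun M => H.card < (M.1.filter (Crosses H)).card + 2 * (a₀ + 1) with hgood
  -- per matching with at most `a₀` internal edges: brick (T-K3), made uniform in `a`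
  have hgoodV : ∀ M ∈ good, V M ≤ B₁ := by
    intro M hM
    have hlt := (mem_filter.1 hM).2
    set π := M.2.partner with hπdef
    have hπ : ∀ v, π (π v) = v := partner_partner M
    have hπ' : ∀ v, π v ≠ v := partner_ne M
    obtain ⟨a, ha⟩ : ∃ a, (reps π (vAA π univ H)).card = a := ⟨_, rfl⟩
    obtain ⟨b, hb⟩ : ∃ b, (reps π (vBH π univ H ∪ vBN π univ H)).card = b := ⟨_, rfl⟩
    have hab : h = 2 * a + b := by rw [← hh, card_eq_two_mul_add_of_types hπ hπ' H, ha, hb]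
    have hbcr : b = (M.1.filter (Crosses H)).card := by rw [← hb, hπdef, card_reps_vB_eq_card_crosses M H]
    have haa₀ : a ≤ a₀ := by rw [← hbcr, hh] at hlt; omega
    have hbh : b ≤ h := by omega
    have hqb : ((b : ℝ) / R) ^ 2 * Real.exp (3 * b / R) ≤ 2 := by
      have h4 := qParam_mono (R := R) hbh
      linarith
    have hV := smallBlockHH_designValue_le hdes M hn H ha hb (D' := D - a) ht (by omega) hR (by omega) (by omega) hqb
      ψ hG hψ0
    -- `C(J, D−a+1)·q_b^{D−a+1} ≤ θ^{D−a+1} ≤ θ^{D−a₀+1}`, `3^a ≤ 3^{a₀}`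
    set qb : ℝ := (1 / 4 : ℝ) * ((b : ℝ) / R) ^ 2 * Real.exp (3 * b / R) with hqbdef
    have hqb0 : 0 ≤ qb := by rw [hqbdef]; positivity
    have hJq : ((((T - 1) / 2 : ℕ)) : ℝ) * qb ≤ θ :=
      le_trans (mul_le_mul_of_nonneg_left (qParam_mono (R := R) hbh) (by positivity)) hθ
    have hC : ((((T - 1) / 2).choose (D - a + 1) : ℕ) : ℝ) * qb ^ (D - a + 1) ≤ θ ^ (D - a₀ + 1) :=
      calc _ ≤ (((((T - 1) / 2 : ℕ)) : ℝ) * qb) ^ (D - a + 1) := choose_mul_pow_le_mul_pow _ _ hqb0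
        _ ≤ θ ^ (D - a + 1) := pow_le_pow_left₀ (by positivity) hJq _
        _ ≤ θ ^ (D - a₀ + 1) := pow_le_pow_of_le_one hθ0 hθ1 (by omega)
    have h3 : (3 : ℝ) ^ a ≤ (3 : ℝ) ^ a₀ := pow_le_pow_right₀ (by norm_num) haa₀
    rw [hB₁]
    calc V M ≤ Bv * ((((T - 1) / 2).choose (D - a + 1) : ℕ) : ℝ) * ((3 : ℝ) ^ a * (G * qb ^ (D - a + 1))) := hV
      _ = Bv * G * ((3 : ℝ) ^ a * (((((T - 1) / 2).choose (D - a + 1) : ℕ) : ℝ) * qb ^ (D - a + 1))) := by ring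
      _ ≤ Bv * G * ((3 : ℝ) ^ a₀ * θ ^ (D - a₀ + 1)) :=
          mul_le_mul_of_nonneg_left (mul_le_mul h3 hC (by positivity) (by positivity)) (by positivity)
  have hallV : ∀ M, V M ≤ B₂ := fun M => by rw [hB₂]; exact blockMask_value_le_trivial hdes M H ψ hG0 hG
  -- the mass of the matchings with more than `a₀` internal edges
  have hbad : (((univ.filter fun M : PMatch n =>
      ¬ (H.card < (M.1.filter (Crosses H)).card + 2 * (a₀ + 1))).card : ℕ) : ℝ) ≤
      ((h : ℝ) + 1) * ρ ^ (a₀ + 1) * (Fintype.card (PMatch n) : ℝ) := by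
    have h1 := card_pmatch_internal_gt_le H (a₀ := a₀) hρ0 (by rw [hh]; exact hρ)
    have e : (univ.filter fun M : PMatch n => ¬ (H.card < (M.1.filter (Crosses H)).card + 2 * (a₀ + 1))) =
        (univ.filter fun M : PMatch n => (M.1.filter (Crosses H)).card + 2 * (a₀ + 1) ≤ H.card) :=
      filter_congr fun M _ => by omega
    rw [e]
    rw [hh] at h1 ⊢
    exact h1
  have hPMpos : ∀ M : PMatch n, (0 : ℝ) < Fintype.card (PMatch n) := fun M => by
    have : 0 < Fintype.card (PMatch n) := Fintype.card_pos_iff.2 ⟨M⟩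
    exact_mod_cast this
  have hsumV : ∑ M : PMatch n, ∑ U : OddSet n, levelWeight n t C w U M * ψ ((U.1 ∩ H).card : ℤ) =
      ∑ M : PMatch n, (Fintype.card (PMatch n) : ℝ)⁻¹ * V M := by
    refine sum_congr rfl fun M _ => ?_
    rw [hVdef]
    simp only []
    rw [← mul_assoc, inv_mul_cancel₀ (hPMpos M).ne', one_mul]
  rw [hsumV, ← mul_sum, ← sum_filter_add_sum_filter_not univ (fun M : PMatch n =>
    H.card < (M.1.filter (Crosses H)).card + 2 * (a₀ + 1))]
  have hgood_sum : ∑ M ∈ good, V M ≤ (good.card : ℝ) * B₁ := by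
    calc ∑ M ∈ good, V M ≤ ∑ M ∈ good, B₁ := sum_le_sum hgoodV
      _ = (good.card : ℝ) * B₁ := by rw [sum_const, nsmul_eq_mul]
  have hbad_sum : ∑ M ∈ univ.filter (fun M : PMatch n => ¬ (H.card < (M.1.filter (Crosses H)).card + 2 * (a₀ + 1))), V M ≤
      (((univ.filter fun M : PMatch n => ¬ (H.card < (M.1.filter (Crosses H)).card + 2 * (a₀ + 1))).card : ℕ) : ℝ) * B₂ := by
    calc _ ≤ ∑ M ∈ univ.filter (fun M : PMatch n => ¬ (H.card < (M.1.filter (Crosses H)).card + 2 * (a₀ + 1))), B₂ :=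
          sum_le_sum fun M _ => hallV M
      _ = _ := by rw [sum_const, nsmul_eq_mul]
  -- assemble
  have hPM := hPMpos M₀
  have hgood_card : (good.card : ℝ) ≤ Fintype.card (PMatch n) := by exact_mod_cast card_filter_le _ _
  have htot : ∑ M ∈ good, V M +
      ∑ M ∈ univ.filter (fun M : PMatch n => ¬ (H.card < (M.1.filter (Crosses H)).card + 2 * (a₀ + 1))), V M ≤
      (Fintype.card (PMatch n) : ℝ) * B₁ + ((h : ℝ) + 1) * ρ ^ (a₀ + 1) * (Fintype.card (PMatch n) : ℝ) * B₂ := by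
    have h1 : (good.card : ℝ) * B₁ ≤ (Fintype.card (PMatch n) : ℝ) * B₁ := mul_le_mul_of_nonneg_right hgood_card hB₁0
    have h2 := mul_le_mul_of_nonneg_right hbad hB₂0
    linarith [hgood_sum, hbad_sum]
  calc (Fintype.card (PMatch n) : ℝ)⁻¹ * (∑ M ∈ good, V M +
        ∑ M ∈ univ.filter (fun M : PMatch n => ¬ (H.card < (M.1.filter (Crosses H)).card + 2 * (a₀ + 1))), V M)
      ≤ (Fintype.card (PMatch n) : ℝ)⁻¹ *
          ((Fintype.card (PMatch n) : ℝ) * B₁ + ((h : ℝ) + 1) * ρ ^ (a₀ + 1) * (Fintype.card (PMatch n) : ℝ) * B₂) :=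
        mul_le_mul_of_nonneg_left htot (by positivity)
    _ = B₁ + ((h : ℝ) + 1) * ρ ^ (a₀ + 1) * B₂ := by field_simp
    _ = Bv * G * ((3 : ℝ) ^ a₀ * θ ^ (D - a₀ + 1) + ((h : ℝ) + 1) * ρ ^ (a₀ + 1)) := by rw [hB₁, hB₂]; ring

/-- **The same with the explicit `ρ = h(h+1)/(n−2h+1)`** (`2h ≤ n`). [cite: Rothvoss2017, §2 (PDF pp. 5–6)]
[cite: Agarwal2000DifferenceEquations, Remark 1.8.1 (1.8.8)] -/
theorem smallBlock_designValue_avg_le' {t T D : ℕ} {Bv : ℝ} {C : Finset ℕ} {w : ℕ → ℝ}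
    (hdes : IsExactDesign n t T D Bv C w) {N : ℕ} (hn : (univ : Finset (Fin n)).card = 2 * N)
    (H : Finset (Fin n)) {h s₀ a₀ R : ℕ} (hh : H.card = h) (h2h : 2 * h ≤ n) (ht : t = 2 * s₀ + 1) (ha₀ : a₀ ≤ D)
    (hR : 1 ≤ R) (hR1 : R + 3 * (D + 1) + h + (T - 1) / 2 ≤ s₀ + 1) (hR2 : R + 3 * (D + 1) + h + s₀ + (T - 1) / 2 + 1 ≤ N)
    (hq : ((h : ℝ) / R) ^ 2 * Real.exp (3 * h / R) ≤ 2) {θ : ℝ}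
    (hθ : ((((T - 1) / 2 : ℕ)) : ℝ) * ((1 / 4 : ℝ) * ((h : ℝ) / R) ^ 2 * Real.exp (3 * h / R)) ≤ θ) (hθ1 : θ ≤ 1)
    (ψ : ℤ → ℝ) {G : ℝ} (hG0 : 0 ≤ G) (hG : ∀ x ∈ Icc (0 : ℤ) (t : ℤ), |ψ x| ≤ G)
    (hψ0 : ∀ x ∈ Icc (0 : ℤ) (t : ℤ), 0 ≤ ψ x) :
    ∑ M : PMatch n, ∑ U : OddSet n, levelWeight n t C w U M * ψ ((U.1 ∩ H).card : ℤ) ≤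
      Bv * G * ((3 : ℝ) ^ a₀ * θ ^ (D - a₀ + 1) +
        ((h : ℝ) + 1) * ((h : ℝ) * ((h : ℝ) + 1) / ((n - 2 * h + 1 : ℕ) : ℝ)) ^ (a₀ + 1)) :=
  smallBlock_designValue_avg_le hdes hn H hh ht ha₀ hR hR1 hR2 hq hθ hθ1 (by positivity)
    (fun b hb => rho_hyp_of_le h2h hb) ψ hG0 hG hψ0

/-! ### §3 (v2) The headline form: blocks of size `≲ √n/3` at `3^{−D/2}` -/

/-- **SMALL BLOCKS, HEADLINE FORM.** For an exact design `(n,t,T,D,B_v,C,w)` with `n = 2N`, `t = 2s₀+1`, a block `|H| = h` with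
`9h(h+1) ≤ n − 2h + 1`, `R ≥ 1` with `R + 3(D+1) + h + (T−1)/2 ≤ s₀+1`, `R + 3(D+1) + h + s₀ + (T−1)/2 + 1 ≤ N`, `(h/R)²e^{3h/R} ≤ 2`,
`((T−1)/2)·¼(h/R)²e^{3h/R} ≤ 1/9`, and every mask `0 ≤ ψ ≤ G` on `[0,t]`:
`Σ_M Σ_U W(U,M)·ψ(|U∩H|) ≤ B_v·G·(h+2)·(1/3)^{⌊D/2⌋}` (§2 with `a₀ = ⌊D/2⌋`, `θ = ρ = 1/9`).
[cite: Rothvoss2017, §2 (PDF pp. 5–6)] [cite: Agarwal2000DifferenceEquations, Remark 1.8.1 (1.8.8)] -/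
theorem smallBlock_designValue_avg_le_three_pow {t T D : ℕ} {Bv : ℝ} {C : Finset ℕ} {w : ℕ → ℝ}
    (hdes : IsExactDesign n t T D Bv C w) {N : ℕ} (hn : (univ : Finset (Fin n)).card = 2 * N)
    (H : Finset (Fin n)) {h s₀ R : ℕ} (hh : H.card = h) (h9 : 9 * (h * (h + 1)) ≤ n - 2 * h + 1) (h2h : 2 * h ≤ n)
    (ht : t = 2 * s₀ + 1) (hR : 1 ≤ R) (hR1 : R + 3 * (D + 1) + h + (T - 1) / 2 ≤ s₀ + 1)
    (hR2 : R + 3 * (D + 1) + h + s₀ + (T - 1) / 2 + 1 ≤ N) (hq : ((h : ℝ) / R) ^ 2 * Real.exp (3 * h / R) ≤ 2)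
    (hθ : ((((T - 1) / 2 : ℕ)) : ℝ) * ((1 / 4 : ℝ) * ((h : ℝ) / R) ^ 2 * Real.exp (3 * h / R)) ≤ 1 / 9)
    (ψ : ℤ → ℝ) {G : ℝ} (hG0 : 0 ≤ G) (hG : ∀ x ∈ Icc (0 : ℤ) (t : ℤ), |ψ x| ≤ G)
    (hψ0 : ∀ x ∈ Icc (0 : ℤ) (t : ℤ), 0 ≤ ψ x) :
    ∑ M : PMatch n, ∑ U : OddSet n, levelWeight n t C w U M * ψ ((U.1 ∩ H).card : ℤ) ≤
      Bv * G * (((h : ℝ) + 2) * (1 / 3 : ℝ) ^ (D / 2)) := by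
  have hBv : 0 ≤ Bv := le_trans (sum_nonneg fun c _ => abs_nonneg _) hdes.2.2.2.2.2.2
  have hρ9 : (h : ℝ) * ((h : ℝ) + 1) / ((n - 2 * h + 1 : ℕ) : ℝ) ≤ 1 / 9 := by
    have hden : (0 : ℝ) < ((n - 2 * h + 1 : ℕ) : ℝ) := by positivity
    rw [div_le_iff₀ hden]
    have : (9 : ℝ) * ((h : ℝ) * ((h : ℝ) + 1)) ≤ ((n - 2 * h + 1 : ℕ) : ℝ) := by exact_mod_cast h9
    linarith
  have hρ0 : 0 ≤ (h : ℝ) * ((h : ℝ) + 1) / ((n - 2 * h + 1 : ℕ) : ℝ) := by positivity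
  have h1 := smallBlock_designValue_avg_le' hdes hn H hh h2h ht (a₀ := D / 2) (Nat.div_le_self _ _) hR hR1 hR2 hq hθ
    (by norm_num) ψ hG0 hG hψ0
  refine h1.trans (mul_le_mul_of_nonneg_left ?_ (mul_nonneg hBv hG0))
  -- `3^{a₀}(1/9)^{D−a₀+1} ≤ (1/3)^{a₀}` and `ρ^{a₀+1} ≤ (1/9)^{a₀+1} ≤ (1/3)^{a₀}`, `a₀ = ⌊D/2⌋`
  set a₀ := D / 2 with ha₀
  have hle : a₀ + 1 ≤ D - a₀ + 1 := by omega
  have e1 : (3 : ℝ) ^ a₀ * (1 / 9 : ℝ) ^ (D - a₀ + 1) ≤ (1 / 3 : ℝ) ^ a₀ := by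
    calc (3 : ℝ) ^ a₀ * (1 / 9 : ℝ) ^ (D - a₀ + 1) ≤ (3 : ℝ) ^ a₀ * (1 / 9 : ℝ) ^ (a₀ + 1) :=
          mul_le_mul_of_nonneg_left (pow_le_pow_of_le_one (by norm_num) (by norm_num) hle) (by positivity)
      _ = (1 / 3 : ℝ) ^ a₀ * (1 / 9) := by
          rw [pow_succ, ← mul_assoc, ← mul_pow]; norm_num
      _ ≤ (1 / 3 : ℝ) ^ a₀ := by
          have : (0 : ℝ) ≤ (1 / 3 : ℝ) ^ a₀ := by positivity
          linarith
  have e2 : ((h : ℝ) * ((h : ℝ) + 1) / ((n - 2 * h + 1 : ℕ) : ℝ)) ^ (a₀ + 1) ≤ (1 / 3 : ℝ) ^ a₀ := by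
    calc _ ≤ (1 / 9 : ℝ) ^ (a₀ + 1) := pow_le_pow_left₀ hρ0 hρ9 _
      _ = (1 / 3 : ℝ) ^ a₀ * ((1 / 3 : ℝ) ^ a₀ * (1 / 9)) := by
          rw [pow_succ, show (1 / 9 : ℝ) = (1 / 3) * (1 / 3) by norm_num, mul_pow]; ring
      _ ≤ (1 / 3 : ℝ) ^ a₀ * 1 := by
          refine mul_le_mul_of_nonneg_left ?_ (by positivity)
          have : (1 / 3 : ℝ) ^ a₀ ≤ 1 := pow_le_one₀ (by norm_num) (by norm_num)
          nlinarith
      _ = (1 / 3 : ℝ) ^ a₀ := mul_one _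
  have hh0 : (0 : ℝ) ≤ (h : ℝ) + 1 := by positivity
  calc (3 : ℝ) ^ a₀ * (1 / 9 : ℝ) ^ (D - a₀ + 1) +
        ((h : ℝ) + 1) * ((h : ℝ) * ((h : ℝ) + 1) / ((n - 2 * h + 1 : ℕ) : ℝ)) ^ (a₀ + 1)
      ≤ (1 / 3 : ℝ) ^ a₀ + ((h : ℝ) + 1) * (1 / 3 : ℝ) ^ a₀ := add_le_add e1 (mul_le_mul_of_nonneg_left e2 hh0)
    _ = ((h : ℝ) + 2) * (1 / 3 : ℝ) ^ (D / 2) := by rw [ha₀]; ring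

end Summit.PneNP.PneNP.Theorems.ChebyshevTracialDesignSmallBlockMaskAverage

end
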